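import Summits.QuantumFields.BalabanUV.Beta.GAN24.BorderedFrameInverse

/-!
# `BalabanUV.Beta.GAN24.BorderedFrameInverseBlocks` — binder row G-an2-4 / (CONV-C), road P1-fibre, typer row **P1-E1** (DAG node N10c), part 2/2:
# block norms, the blocks of `frameInv`, `‖frameInv‖ ≤ 1/τ + 1/|β| + 1/|α| + |ε|/|αβ|`, and the ASSEMBLED frame + Neumann engine with its
# BLOCKWISE corollaries (typer row P1-E1 (iii))

NOT IN PRINT; OUR PROOF ATTEMPT (of the road; THIS file is [folklore] finite-dimensional linear algebra, Mathlib + part 1 only).  HONEST FRAMING (cell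
contract, verbatim): «discharging `BetaPertH` makes Bałaban's UV stability UNCONDITIONAL — a real constructive-QFT result; it is NOT the continuum limit
and NOT the Clay problem.»  HONEST DEPENDENCY (verbatim): «continuum YM on T⁴ ⇐ BetaPertH ∧ nine spine estimates (0/9 proved); BetaPertH ⇐ (D1) ∧ (D4) ∧
CAP+tail; G-an2-4 gates asym, D1 and NE2/3/4.»  No cited fact, no wall binder, no `def … : Prop` hypothesis, no new definition; discharges NOTHING of the
K-slot of (CONV-C); NOT summit progress.  Consumer: typer row P1-L08d (`GAN24/CapInverseSmall`).

## What is proved (notation of part 1: `uuH u = uuᴴ`, `pinvT P u = P⁺`, `frameModel P u ε α β = C₀`, `frameInv P u ε α β = C₀⁻¹`; Euclidean operator norms)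
* §5 split vectors / block matrices: `norm_sq_toLp_sumElim` (`‖(v,w)‖² = ‖v‖² + ‖w‖²`), `norm_toLp_le_inl/inr`, `norm_toLp_sumElim_le`, `norm_toLp_star`,
  `norm_star_dotProduct_le` (Cauchy–Schwarz in `⬝ᵥ` currency), `norm_fromBlocks_le` (`‖fromBlocks A B C D‖ ≤ ‖A‖+‖B‖+‖C‖+‖D‖`), `norm_toBlocks₁₁_le`
  (`‖M₁₁‖ ≤ ‖M‖`), `norm_apply_le_norm`, `norm_single_le`, `opNorm_le_sum_entries` (`‖A‖ ≤ Σ_{ij} |A i j|`: entrywise → operator currency; the converse is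
  part 1's `norm_entry_le`).
* §6 on `ι ⊕ Unit`: `norm_col_inr_le`/`norm_row_inr_le` (the `φc` column / `cφ` row of `M` have Euclidean norm `≤ ‖M‖`); the blocks of `frameInv`
  (`frameInv_toBlocks₁₁ = P⁺`, `frameInv_col = β⁻¹ u`, `frameInv_row = α⁻¹ uᴴ`, `frameInv_cc = −ε/(αβ)`); `norm_toLp_of_unit` (`uᴴu = 1 ⇒ ‖u‖₂ = 1`);
  BLOCKWISE NEARNESS of any `R` to `frameInv`, each `≤ ‖R − frameInv‖`: `norm_toBlocks₁₁_sub_pinvT_le` (⊥⊥), `norm_uu_le` (the `uu` element of `R_{φφ}`,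
  which VANISHES at `R = frameInv`), `norm_col_sub_le` (u,c), `norm_row_sub_le` (c,u), `norm_cc_sub_le` (c,c); `norm_replicateCol_unit_le`,
  `norm_replicateRow_unit_le`, `norm_unitBlock_le`; **`norm_frameInv_le`**: `‖frameInv‖ ≤ 1/τ + 1/|β| + 1/|α| + |ε|/(|α||β|)` under transverse coercivity.
* §7 **`frame_neumann`** (`‖E‖·‖frameInv‖ ≤ 1/2 ⇒ C₀ + E` invertible, `‖(C₀+E)⁻¹‖ ≤ 2‖frameInv‖`, `‖(C₀+E)⁻¹ − frameInv‖ ≤ 2‖frameInv‖²‖E‖`) and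
  **`frame_neumann_of_coercive`** (the same from coercivity with the explicit constant `K = 1/τ + 1/|β| + 1/|α| + |ε|/(|α||β|)`: `‖E‖·K ≤ 1/2` suffices,
  bounds `2K`, `2K²‖E‖`).  With `R = (C₀+E)⁻¹` the §6 nearness lemmas give row P1-E1 (iii) verbatim: `(⊥⊥) = P⁺ + O(‖E‖)`, `uu = O(‖E‖)`, `(u,c) = 1/β + O`,
  `(c,u) = 1/α + O`, `(c,c) = −ε/(αβ) + O`, all `O` = `2K²‖E‖`.
-/

open Matrix WithLp Complex
open scoped ComplexConjugate Matrix.Norms.L2Operator InnerProductSpace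

namespace Summit.QuantumFields.BalabanUV.Beta.GAN24.BorderedFrameInverseBlocks

open Summit.QuantumFields.BalabanUV.Beta.GAN24.BorderedFrameInverse

/-! ### §5 Euclidean norms of split vectors and block matrices -/
section Blocks

variable {m n o o' : Type*} [Fintype m] [Fintype n] [Fintype o] [Fintype o']

/-- [folklore] `‖(v, w)‖₂² = ‖v‖₂² + ‖w‖₂²`. -/
theorem norm_sq_toLp_sumElim (v : m → ℂ) (w : o → ℂ) :
    ‖(toLp 2 (Sum.elim v w) : EuclideanSpace ℂ (m ⊕ o))‖ ^ 2 =
      ‖(toLp 2 v : EuclideanSpace ℂ m)‖ ^ 2 + ‖(toLp 2 w : EuclideanSpace ℂ o)‖ ^ 2 := by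
  simp [EuclideanSpace.norm_sq_eq, Fintype.sum_sum_type]

/-- [folklore] `‖v‖₂ ≤ ‖(v, w)‖₂`. -/
theorem norm_toLp_le_inl (v : m → ℂ) (w : o → ℂ) :
    ‖(toLp 2 v : EuclideanSpace ℂ m)‖ ≤ ‖(toLp 2 (Sum.elim v w) : EuclideanSpace ℂ (m ⊕ o))‖ :=
  le_of_pow_le_pow_left₀ two_ne_zero (norm_nonneg _)
    (by rw [norm_sq_toLp_sumElim]; nlinarith [sq_nonneg ‖(toLp 2 w : EuclideanSpace ℂ o)‖])

/-- [folklore] `‖w‖₂ ≤ ‖(v, w)‖₂`. -/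
theorem norm_toLp_le_inr (v : m → ℂ) (w : o → ℂ) :
    ‖(toLp 2 w : EuclideanSpace ℂ o)‖ ≤ ‖(toLp 2 (Sum.elim v w) : EuclideanSpace ℂ (m ⊕ o))‖ :=
  le_of_pow_le_pow_left₀ two_ne_zero (norm_nonneg _)
    (by rw [norm_sq_toLp_sumElim]; nlinarith [sq_nonneg ‖(toLp 2 v : EuclideanSpace ℂ m)‖])

/-- [folklore] `‖(v, 0)‖₂ = ‖v‖₂`. -/
theorem norm_toLp_sumElim_zero (v : m → ℂ) :
    ‖(toLp 2 (Sum.elim v (0 : o → ℂ)) : EuclideanSpace ℂ (m ⊕ o))‖ = ‖(toLp 2 v : EuclideanSpace ℂ m)‖ := by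
  have h := norm_sq_toLp_sumElim v (0 : o → ℂ)
  rw [toLp_zero, norm_zero, zero_pow two_ne_zero, add_zero] at h
  exact (pow_left_inj₀ (norm_nonneg _) (norm_nonneg _) two_ne_zero).1 h

/-- [folklore] `‖(0, w)‖₂ = ‖w‖₂`. -/
theorem norm_toLp_zero_sumElim (w : o → ℂ) :
    ‖(toLp 2 (Sum.elim (0 : m → ℂ) w) : EuclideanSpace ℂ (m ⊕ o))‖ = ‖(toLp 2 w : EuclideanSpace ℂ o)‖ := by
  have h := norm_sq_toLp_sumElim (0 : m → ℂ) w
  rw [toLp_zero, norm_zero, zero_pow two_ne_zero, zero_add] at h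
  exact (pow_left_inj₀ (norm_nonneg _) (norm_nonneg _) two_ne_zero).1 h

/-- [folklore] `‖(v, w)‖₂ ≤ ‖v‖₂ + ‖w‖₂`. -/
theorem norm_toLp_sumElim_le (v : m → ℂ) (w : o → ℂ) :
    ‖(toLp 2 (Sum.elim v w) : EuclideanSpace ℂ (m ⊕ o))‖ ≤
      ‖(toLp 2 v : EuclideanSpace ℂ m)‖ + ‖(toLp 2 w : EuclideanSpace ℂ o)‖ := by
  have h : Sum.elim v w = Sum.elim v (0 : o → ℂ) + Sum.elim (0 : m → ℂ) w := by ext (i | i) <;> simp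
  rw [h, toLp_add, ← norm_toLp_sumElim_zero (o := o) v, ← norm_toLp_zero_sumElim (m := m) w]
  exact norm_add_le _ _

/-- [folklore] `‖star v‖₂ = ‖v‖₂`. -/
theorem norm_toLp_star (v : m → ℂ) :
    ‖(toLp 2 (star v) : EuclideanSpace ℂ m)‖ = ‖(toLp 2 v : EuclideanSpace ℂ m)‖ := by
  simp [EuclideanSpace.norm_eq]

/-- [folklore] Cauchy–Schwarz in dot-product currency: `|star v ⬝ᵥ y| ≤ ‖v‖₂ ‖y‖₂`. -/
theorem norm_star_dotProduct_le (v : m → ℂ) (y : EuclideanSpace ℂ m) :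
    ‖star v ⬝ᵥ ofLp y‖ ≤ ‖(toLp 2 v : EuclideanSpace ℂ m)‖ * ‖y‖ := by
  have : star v ⬝ᵥ ofLp y = ⟪(toLp 2 v : EuclideanSpace ℂ m), y⟫_ℂ := by
    rw [EuclideanSpace.inner_eq_star_dotProduct, dotProduct_comm, ofLp_toLp]
  rw [this]; exact norm_inner_le_norm _ _

/-- [folklore] A vector in `EuclideanSpace ℂ Unit` has norm `|x ()|`. -/
theorem norm_euclidean_unit (x : EuclideanSpace ℂ Unit) : ‖x‖ = ‖ofLp x ()‖ := by
  rw [EuclideanSpace.norm_eq, Fintype.sum_unique, Real.sqrt_sq (norm_nonneg _)]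

variable [DecidableEq n] [DecidableEq o']

/-- [folklore] **`‖fromBlocks A B C D‖ ≤ ‖A‖ + ‖B‖ + ‖C‖ + ‖D‖`** (Euclidean operator norms). -/
theorem norm_fromBlocks_le (A : Matrix m n ℂ) (B : Matrix m o' ℂ) (C : Matrix o n ℂ) (D : Matrix o o' ℂ) :
    ‖fromBlocks A B C D‖ ≤ ‖A‖ + ‖B‖ + ‖C‖ + ‖D‖ := by
  rw [Matrix.l2_opNorm_def]
  refine ContinuousLinearMap.opNorm_le_bound _ (by positivity) fun z => ?_
  change ‖(toLp 2 (fromBlocks A B C D *ᵥ ofLp z) : EuclideanSpace ℂ (m ⊕ o))‖ ≤ _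
  set x : EuclideanSpace ℂ n := toLp 2 (ofLp z ∘ Sum.inl) with hx
  set y : EuclideanSpace ℂ o' := toLp 2 (ofLp z ∘ Sum.inr) with hy
  have hz : ofLp z = Sum.elim (ofLp x) (ofLp y) := by rw [hx, hy, ofLp_toLp, ofLp_toLp, Sum.elim_comp_inl_inr]
  have hxz : ‖x‖ ≤ ‖z‖ := by
    have := norm_toLp_le_inl (ofLp x) (ofLp y); rwa [← hz, toLp_ofLp, toLp_ofLp] at this
  have hyz : ‖y‖ ≤ ‖z‖ := by
    have := norm_toLp_le_inr (ofLp x) (ofLp y); rwa [← hz, toLp_ofLp, toLp_ofLp] at this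
  rw [fromBlocks_mulVec]
  calc ‖(toLp 2 (Sum.elim (A *ᵥ (ofLp z ∘ Sum.inl) + B *ᵥ (ofLp z ∘ Sum.inr))
          (C *ᵥ (ofLp z ∘ Sum.inl) + D *ᵥ (ofLp z ∘ Sum.inr))) : EuclideanSpace ℂ (m ⊕ o))‖
      ≤ ‖(toLp 2 (A *ᵥ ofLp x + B *ᵥ ofLp y) : EuclideanSpace ℂ m)‖
          + ‖(toLp 2 (C *ᵥ ofLp x + D *ᵥ ofLp y) : EuclideanSpace ℂ o)‖ := norm_toLp_sumElim_le _ _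
    _ ≤ (‖(toLp 2 (A *ᵥ ofLp x) : EuclideanSpace ℂ m)‖ + ‖(toLp 2 (B *ᵥ ofLp y) : EuclideanSpace ℂ m)‖)
          + (‖(toLp 2 (C *ᵥ ofLp x) : EuclideanSpace ℂ o)‖ + ‖(toLp 2 (D *ᵥ ofLp y) : EuclideanSpace ℂ o)‖) := by
        rw [toLp_add, toLp_add]; exact add_le_add (norm_add_le _ _) (norm_add_le _ _)
    _ ≤ (‖A‖ * ‖x‖ + ‖B‖ * ‖y‖) + (‖C‖ * ‖x‖ + ‖D‖ * ‖y‖) := by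
        gcongr <;> exact Matrix.l2_opNorm_mulVec _ _
    _ ≤ (‖A‖ * ‖z‖ + ‖B‖ * ‖z‖) + (‖C‖ * ‖z‖ + ‖D‖ * ‖z‖) := by gcongr
    _ = (‖A‖ + ‖B‖ + ‖C‖ + ‖D‖) * ‖z‖ := by ring

/-- [folklore] **`‖M₁₁‖ ≤ ‖M‖`** for the upper-left block. -/
theorem norm_toBlocks₁₁_le (M : Matrix (m ⊕ o) (n ⊕ o') ℂ) : ‖M.toBlocks₁₁‖ ≤ ‖M‖ := by
  rw [Matrix.l2_opNorm_def]
  refine ContinuousLinearMap.opNorm_le_bound _ (norm_nonneg _) fun x => ?_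
  change ‖(toLp 2 (M.toBlocks₁₁ *ᵥ ofLp x) : EuclideanSpace ℂ m)‖ ≤ _
  have key : M *ᵥ Sum.elim (ofLp x) 0 = Sum.elim (M.toBlocks₁₁ *ᵥ ofLp x) (M.toBlocks₂₁ *ᵥ ofLp x) := by
    conv_lhs => rw [← fromBlocks_toBlocks M]
    rw [fromBlocks_mulVec, Sum.elim_comp_inl, Sum.elim_comp_inr, mulVec_zero, mulVec_zero, add_zero, add_zero]
  set y : EuclideanSpace ℂ (n ⊕ o') := toLp 2 (Sum.elim (ofLp x) (0 : o' → ℂ)) with hy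
  have hy' : ‖y‖ = ‖x‖ := by rw [hy, norm_toLp_sumElim_zero, toLp_ofLp]
  calc ‖(toLp 2 (M.toBlocks₁₁ *ᵥ ofLp x) : EuclideanSpace ℂ m)‖
      ≤ ‖(toLp 2 (Sum.elim (M.toBlocks₁₁ *ᵥ ofLp x) (M.toBlocks₂₁ *ᵥ ofLp x)) : EuclideanSpace ℂ (m ⊕ o))‖ :=
        norm_toLp_le_inl _ _
    _ = ‖(toLp 2 (M *ᵥ ofLp y) : EuclideanSpace ℂ (m ⊕ o))‖ := by rw [hy, ofLp_toLp, key]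
    _ ≤ ‖M‖ * ‖y‖ := Matrix.l2_opNorm_mulVec _ _
    _ = ‖M‖ * ‖x‖ := by rw [hy']

variable [DecidableEq m]

/-- [folklore] A coordinate is bounded by the Euclidean norm: `|x j| ≤ ‖x‖₂`. -/
theorem norm_apply_le_norm (x : EuclideanSpace ℂ n) (j : n) : ‖ofLp x j‖ ≤ ‖x‖ := by
  have h := norm_inner_le_norm (𝕜 := ℂ) (EuclideanSpace.single j (1 : ℂ)) x
  rw [EuclideanSpace.inner_single_left, map_one, one_mul, EuclideanSpace.single, PiLp.norm_single, norm_one,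
    one_mul] at h
  exact h

/-- [folklore] `‖single i j c‖ ≤ |c|` for the elementary matrices. -/
theorem norm_single_le (i : m) (j : n) (c : ℂ) : ‖Matrix.single i j c‖ ≤ ‖c‖ := by
  rw [Matrix.l2_opNorm_def]
  refine ContinuousLinearMap.opNorm_le_bound _ (norm_nonneg _) fun x => ?_
  change ‖(toLp 2 (Matrix.single i j c *ᵥ ofLp x) : EuclideanSpace ℂ m)‖ ≤ _
  rw [single_mulVec, show Function.update (0 : m → ℂ) i (c * ofLp x j) = Pi.single i (c * ofLp x j) from rfl,
    PiLp.toLp_single, PiLp.norm_single, norm_mul]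
  gcongr
  exact norm_apply_le_norm x j

/-- [folklore] **Entries control the operator norm**: `‖A‖ ≤ Σ_{i,j} |A i j|` (the currency switch for consumers holding entrywise bounds;
conversely `norm_entry_le`). -/
theorem opNorm_le_sum_entries (A : Matrix m n ℂ) : ‖A‖ ≤ ∑ i, ∑ j, ‖A i j‖ := by
  calc ‖A‖ = ‖∑ i, ∑ j, Matrix.single i j (A i j)‖ := congrArg _ (matrix_eq_sum_single A)
    _ ≤ ∑ i, ‖∑ j, Matrix.single i j (A i j)‖ := norm_sum_le _ _
    _ ≤ ∑ i, ∑ j, ‖Matrix.single i j (A i j)‖ := Finset.sum_le_sum fun i _ => norm_sum_le _ _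
    _ ≤ ∑ i, ∑ j, ‖A i j‖ := Finset.sum_le_sum fun i _ => Finset.sum_le_sum fun j _ => norm_single_le i j _

end Blocks

/-! ### §6 Blocks of matrices on `ι ⊕ Unit`; the blocks of `frameInv`; `‖frameInv‖` -/
section FrameBlocks

variable {ι : Type*} [Fintype ι] [DecidableEq ι] {P : Matrix ι ι ℂ} {u : ι → ℂ} {τ : ℝ} {ε α β : ℂ}

/-- [folklore] The `φc` column is bounded by the operator norm. -/
theorem norm_col_inr_le (M : Matrix (ι ⊕ Unit) (ι ⊕ Unit) ℂ) :
    ‖(toLp 2 (fun i => M (Sum.inl i) (Sum.inr ())) : EuclideanSpace ℂ ι)‖ ≤ ‖M‖ := by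
  have h1 : ‖(toLp 2 (fun k => M k (Sum.inr ())) : EuclideanSpace ℂ (ι ⊕ Unit))‖ ≤ ‖M‖ := by
    have h := Matrix.l2_opNorm_mulVec M (PiLp.single 2 (Sum.inr ()) (1 : ℂ))
    rw [PiLp.ofLp_single, mulVec_single_one, PiLp.norm_single, norm_one, mul_one] at h
    exact h
  have h2 : (fun k => M k (Sum.inr ())) = Sum.elim (fun i => M (Sum.inl i) (Sum.inr ())) (fun j => M (Sum.inr j) (Sum.inr ())) := by
    ext (k | k) <;> rfl
  rw [h2] at h1
  exact (norm_toLp_le_inl _ _).trans h1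

/-- [folklore] The `cφ` row is bounded by the operator norm. -/
theorem norm_row_inr_le (M : Matrix (ι ⊕ Unit) (ι ⊕ Unit) ℂ) :
    ‖(toLp 2 (fun i => M (Sum.inr ()) (Sum.inl i)) : EuclideanSpace ℂ ι)‖ ≤ ‖M‖ := by
  have h := norm_col_inr_le Mᴴ
  rw [Matrix.l2_opNorm_conjTranspose] at h
  have : (fun i => M (Sum.inr ()) (Sum.inl i)) = star (fun i => Mᴴ (Sum.inl i) (Sum.inr ())) := by
    ext i; simp [conjTranspose_apply]
  rw [this, norm_toLp_star]; exact h

/-- [folklore] `(frameInv)_{φφ} = P⁺`. -/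
theorem frameInv_toBlocks₁₁ : (frameInv P u ε α β).toBlocks₁₁ = pinvT P u := by
  rw [frameInv, toBlocks_fromBlocks₁₁]

/-- [folklore] `(frameInv)_{φc} = β⁻¹ u`. -/
theorem frameInv_col : (fun i => frameInv P u ε α β (Sum.inl i) (Sum.inr ())) = β⁻¹ • u := by
  ext i; simp [frameInv, replicateCol_apply]

/-- [folklore] `(frameInv)_{cφ} = α⁻¹ uᴴ`. -/
theorem frameInv_row : (fun i => frameInv P u ε α β (Sum.inr ()) (Sum.inl i)) = α⁻¹ • star u := by
  ext i; simp [frameInv, replicateRow_apply]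

/-- [folklore] `(frameInv)_{cc} = −ε/(αβ)`. -/
theorem frameInv_cc : frameInv P u ε α β (Sum.inr ()) (Sum.inr ()) = -(ε / (α * β)) := by
  simp [frameInv]

omit [DecidableEq ι] in
/-- [folklore] `uᴴu = 1` in Euclidean-norm form: `‖u‖₂ = 1`. -/
theorem norm_toLp_of_unit (hu : star u ⬝ᵥ u = 1) : ‖(toLp 2 u : EuclideanSpace ℂ ι)‖ = 1 := by
  have h := re_star_dotProduct_self u
  rw [hu, Complex.one_re] at h
  exact (pow_eq_one_iff_of_nonneg (norm_nonneg _) two_ne_zero).1 h.symm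

/-! Blockwise NEARNESS of an arbitrary `R` (in practice `R = (C₀ + E)⁻¹`) to `frameInv`, each controlled by `‖R − frameInv‖` — combine with the
third bound of `frame_neumann` (`≤ 2‖frameInv‖²‖E‖`). -/

/-- [folklore] (⊥⊥): `‖R_{φφ} − P⁺‖ ≤ ‖R − frameInv‖`. -/
theorem norm_toBlocks₁₁_sub_pinvT_le (R : Matrix (ι ⊕ Unit) (ι ⊕ Unit) ℂ) :
    ‖R.toBlocks₁₁ - pinvT P u‖ ≤ ‖R - frameInv P u ε α β‖ := by
  rw [← frameInv_toBlocks₁₁ (P := P) (u := u) (ε := ε) (α := α) (β := β)]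
  exact norm_toBlocks₁₁_le (R - frameInv P u ε α β)

/-- [folklore] (uu): the `uu` matrix element of `R_{φφ}` is `O(‖R − frameInv‖)` — it VANISHES for `R = frameInv` (`uᴴ P⁺ u = 0`). -/
theorem norm_uu_le (hu : star u ⬝ᵥ u = 1) (hPu : P *ᵥ u = 0) (hA : IsUnit (P + uuH u))
    (R : Matrix (ι ⊕ Unit) (ι ⊕ Unit) ℂ) :
    ‖star u ⬝ᵥ (R.toBlocks₁₁ *ᵥ u)‖ ≤ ‖R - frameInv P u ε α β‖ := by
  have h1 : star u ⬝ᵥ (R.toBlocks₁₁ *ᵥ u) = star u ⬝ᵥ ((R.toBlocks₁₁ - pinvT P u) *ᵥ u) := by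
    rw [sub_mulVec, pinvT_mulVec_u hu hPu hA, sub_zero]
  have h2 := norm_dotProduct_mulVec_le (R.toBlocks₁₁ - pinvT P u) (toLp 2 u) (toLp 2 u)
  rw [ofLp_toLp, norm_toLp_of_unit hu, one_mul, mul_one] at h2
  rw [h1]
  exact h2.trans (norm_toBlocks₁₁_sub_pinvT_le R)

/-- [folklore] (u,c): `‖R_{φc} − β⁻¹ u‖₂ ≤ ‖R − frameInv‖`. -/
theorem norm_col_sub_le (R : Matrix (ι ⊕ Unit) (ι ⊕ Unit) ℂ) :
    ‖(toLp 2 (fun i => R (Sum.inl i) (Sum.inr ())) : EuclideanSpace ℂ ι) - toLp 2 (β⁻¹ • u)‖ ≤ ‖R - frameInv P u ε α β‖ := by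
  rw [← frameInv_col (P := P) (ε := ε) (α := α), ← toLp_sub]
  exact norm_col_inr_le (R - frameInv P u ε α β)

/-- [folklore] (c,u): `‖R_{cφ} − α⁻¹ uᴴ‖₂ ≤ ‖R − frameInv‖`. -/
theorem norm_row_sub_le (R : Matrix (ι ⊕ Unit) (ι ⊕ Unit) ℂ) :
    ‖(toLp 2 (fun i => R (Sum.inr ()) (Sum.inl i)) : EuclideanSpace ℂ ι) - toLp 2 (α⁻¹ • star u)‖ ≤
      ‖R - frameInv P u ε α β‖ := by
  rw [← frameInv_row (P := P) (ε := ε) (β := β), ← toLp_sub]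
  exact norm_row_inr_le (R - frameInv P u ε α β)

/-- [folklore] (c,c): `|R_{cc} + ε/(αβ)| ≤ ‖R − frameInv‖`. -/
theorem norm_cc_sub_le (R : Matrix (ι ⊕ Unit) (ι ⊕ Unit) ℂ) :
    ‖R (Sum.inr ()) (Sum.inr ()) + ε / (α * β)‖ ≤ ‖R - frameInv P u ε α β‖ := by
  have h := norm_entry_le (R - frameInv P u ε α β) (Sum.inr ()) (Sum.inr ())
  rwa [Matrix.sub_apply, frameInv_cc, sub_neg_eq_add] at h

/-! `‖frameInv‖ ≤ 1/τ + 1/|β| + 1/|α| + |ε|/|αβ|` -/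

omit [DecidableEq ι] in
/-- [folklore] `‖col v‖ ≤ ‖v‖₂`. -/
theorem norm_replicateCol_unit_le (v : ι → ℂ) : ‖replicateCol Unit v‖ ≤ ‖(toLp 2 v : EuclideanSpace ℂ ι)‖ := by
  rw [Matrix.l2_opNorm_def]
  refine ContinuousLinearMap.opNorm_le_bound _ (norm_nonneg _) fun c => ?_
  change ‖(toLp 2 (replicateCol Unit v *ᵥ ofLp c) : EuclideanSpace ℂ ι)‖ ≤ _
  have : replicateCol Unit v *ᵥ ofLp c = (ofLp c ()) • v := by
    ext i; simp [mulVec, dotProduct, replicateCol_apply, mul_comm]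
  rw [this, toLp_smul, norm_smul, norm_euclidean_unit c, mul_comm]

/-- [folklore] `‖row w‖ ≤ ‖w‖₂`. -/
theorem norm_replicateRow_unit_le (w : ι → ℂ) : ‖replicateRow Unit w‖ ≤ ‖(toLp 2 w : EuclideanSpace ℂ ι)‖ := by
  rw [Matrix.l2_opNorm_def]
  refine ContinuousLinearMap.opNorm_le_bound _ (norm_nonneg _) fun x => ?_
  change ‖(toLp 2 (replicateRow Unit w *ᵥ ofLp x) : EuclideanSpace ℂ Unit)‖ ≤ _
  rw [norm_euclidean_unit]
  change ‖w ⬝ᵥ ofLp x‖ ≤ _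
  have h := norm_star_dotProduct_le (star w) x
  rwa [star_star, norm_toLp_star] at h

/-- [folklore] `‖(c)‖ ≤ |c|` for a `Unit × Unit` block. -/
theorem norm_unitBlock_le (c : ℂ) : ‖(of fun _ _ => c : Matrix Unit Unit ℂ)‖ ≤ ‖c‖ := by
  rw [Matrix.l2_opNorm_def]
  refine ContinuousLinearMap.opNorm_le_bound _ (norm_nonneg _) fun x => ?_
  change ‖(toLp 2 ((of fun _ _ => c : Matrix Unit Unit ℂ) *ᵥ ofLp x) : EuclideanSpace ℂ Unit)‖ ≤ _
  have : (of fun _ _ => c : Matrix Unit Unit ℂ) *ᵥ ofLp x = c • ofLp x := by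
    ext i; simp [mulVec, dotProduct]
  rw [this, toLp_smul, toLp_ofLp, norm_smul]

/-- [folklore] **THE FRAME INVERSE IS BOUNDED BY THE FRAME CONSTANTS ONLY**: `‖frameInv‖ ≤ 1/τ + 1/|β| + 1/|α| + |ε|/(|α||β|)` under
transverse coercivity — the N-uniformity mechanism of A4′(iii) (every constant is a frame constant). -/
theorem norm_frameInv_le (hu : star u ⬝ᵥ u = 1) (hPu : P *ᵥ u = 0) (huP : star u ᵥ* P = 0) (hτ : 0 < τ)
    (hco : ∀ x : ι → ℂ, star u ⬝ᵥ x = 0 → τ * (∑ i, ‖x i‖ ^ 2) ≤ (star x ⬝ᵥ (P *ᵥ x)).re) :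
    ‖frameInv P u ε α β‖ ≤ 1 / τ + ‖β‖⁻¹ + ‖α‖⁻¹ + ‖ε‖ / (‖α‖ * ‖β‖) := by
  have h1 := norm_pinvT_le hu hPu huP hτ hco
  have h2 : ‖replicateCol Unit (β⁻¹ • u)‖ ≤ ‖β‖⁻¹ :=
    (norm_replicateCol_unit_le _).trans (by rw [toLp_smul, norm_smul, norm_inv, norm_toLp_of_unit hu, mul_one])
  have h3 : ‖replicateRow Unit (α⁻¹ • star u)‖ ≤ ‖α‖⁻¹ :=
    (norm_replicateRow_unit_le _).trans
      (by rw [toLp_smul, norm_smul, norm_inv, norm_toLp_star, norm_toLp_of_unit hu, mul_one])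
  have h4 : ‖(of fun _ _ => -(ε / (α * β)) : Matrix Unit Unit ℂ)‖ ≤ ‖ε‖ / (‖α‖ * ‖β‖) :=
    (norm_unitBlock_le _).trans (by rw [norm_neg, norm_div, norm_mul])
  rw [frameInv]
  exact (norm_fromBlocks_le _ _ _ _).trans (by linarith)

/-! ### §7 The assembled engine -/

/-- **FRAME + NEUMANN** (typer row P1-E1 (ii)+(iii), [folklore]): if `P u = 0`, `uᴴP = 0`, `uᴴu = 1`, `P` injective on `u⊥`, `α β ≠ 0`, and a perturbation
`E` satisfies `‖E‖·‖frameInv‖ ≤ 1/2`, then `C₀ + E` (`C₀ = frameModel P u ε α β`) is invertible with `‖(C₀+E)⁻¹‖ ≤ 2‖frameInv‖` and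
`‖(C₀+E)⁻¹ − frameInv‖ ≤ 2‖frameInv‖²‖E‖`; blockwise consequences by `norm_toBlocks₁₁_sub_pinvT_le`, `norm_uu_le`, `norm_col_sub_le`,
`norm_row_sub_le`, `norm_cc_sub_le` with `R = (C₀+E)⁻¹`. -/
theorem frame_neumann (hu : star u ⬝ᵥ u = 1) (hPu : P *ᵥ u = 0) (huP : star u ᵥ* P = 0) (hA : IsUnit (P + uuH u))
    (hα : α ≠ 0) (hβ : β ≠ 0) {E : Matrix (ι ⊕ Unit) (ι ⊕ Unit) ℂ} (hE : ‖E‖ * ‖frameInv P u ε α β‖ ≤ 1 / 2) :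
    IsUnit (frameModel P u ε α β + E) ∧ ‖(frameModel P u ε α β + E)⁻¹‖ ≤ 2 * ‖frameInv P u ε α β‖ ∧
      ‖(frameModel P u ε α β + E)⁻¹ - frameInv P u ε α β‖ ≤ 2 * ‖frameInv P u ε α β‖ ^ 2 * ‖E‖ := by
  have hinv := inv_frameModel hu hPu huP hA hα hβ (ε := ε)
  have h := neumann (isUnit_frameModel hu hPu huP hA hα hβ (ε := ε)) (E := E) (by rw [hinv]; exact hE)
  rw [hinv] at h
  exact h

/-- **FRAME + NEUMANN FROM COERCIVITY WITH EXPLICIT CONSTANT** ([folklore]; the form consumed by row P1-L08d): with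
`K := 1/τ + 1/|β| + 1/|α| + |ε|/(|α||β|)`, transverse coercivity `τ Σ‖x i‖² ≤ Re(xᴴPx)` on `u⊥` (`τ > 0`), `P u = 0`, `uᴴP = 0`, `uᴴu = 1`,
`α β ≠ 0` and `‖E‖·K ≤ 1/2`: `C₀ + E` is invertible, `‖(C₀+E)⁻¹‖ ≤ 2K`, `‖(C₀+E)⁻¹ − frameInv‖ ≤ 2K²‖E‖`. -/
theorem frame_neumann_of_coercive (hu : star u ⬝ᵥ u = 1) (hPu : P *ᵥ u = 0) (huP : star u ᵥ* P = 0) (hτ : 0 < τ)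
    (hco : ∀ x : ι → ℂ, star u ⬝ᵥ x = 0 → τ * (∑ i, ‖x i‖ ^ 2) ≤ (star x ⬝ᵥ (P *ᵥ x)).re)
    (hα : α ≠ 0) (hβ : β ≠ 0) {E : Matrix (ι ⊕ Unit) (ι ⊕ Unit) ℂ}
    (hE : ‖E‖ * (1 / τ + ‖β‖⁻¹ + ‖α‖⁻¹ + ‖ε‖ / (‖α‖ * ‖β‖)) ≤ 1 / 2) :
    IsUnit (frameModel P u ε α β + E) ∧
      ‖(frameModel P u ε α β + E)⁻¹‖ ≤ 2 * (1 / τ + ‖β‖⁻¹ + ‖α‖⁻¹ + ‖ε‖ / (‖α‖ * ‖β‖)) ∧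
      ‖(frameModel P u ε α β + E)⁻¹ - frameInv P u ε α β‖ ≤
        2 * (1 / τ + ‖β‖⁻¹ + ‖α‖⁻¹ + ‖ε‖ / (‖α‖ * ‖β‖)) ^ 2 * ‖E‖ := by
  have hK := norm_frameInv_le (ε := ε) (α := α) (β := β) hu hPu huP hτ hco
  have hA : IsUnit (P + uuH u) := isUnit_aug hu huP (inj_of_coercive hτ hco)
  obtain ⟨h1, h2, h3⟩ := frame_neumann (ε := ε) hu hPu huP hA hα hβ (E := E)
    ((mul_le_mul_of_nonneg_left hK (norm_nonneg E)).trans hE)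
  refine ⟨h1, h2.trans (by gcongr), h3.trans ?_⟩
  have := norm_nonneg (frameInv P u ε α β)
  gcongr

end FrameBlocks

end Summit.QuantumFields.BalabanUV.Beta.GAN24.BorderedFrameInverseBlocks
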